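import Mathlib
import HarnessLib
import HarnessLib.Audit
import Summits.AtomisticToContinuum.Statement
import Literature.Analysis.FluidPDE.PolydisperseHardSphereFlow
import HarnessLib.Audit.Status.Attr

/-!
Route: EinsteinBathSolvent

DORMANT since 2026-08-23T04:17:48Z (reconciler: no traction for 5.9 d (last activity item-evidence-added at 2026-08-17T06:18:57Z); parked, not closed — `ledger route dormant route-AtomisticToContinuum-EinsteinBathSolvent --off` to react) — unstaffed, not closed; items shared with open routes are served there. `ledger route dormant <id> --off` reactivates.

# Route EinsteinBathSolvent — Euler for hard spheres in a negligible ideal light-gas bath (OVY's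
noise manufactured mechanically), then remove the vanishing solvent

X = EinsteinBathEuler ∧ BathRemoval ("it suffices to show"; realises card
einstein-bath-vanishing-solvent; conforming re-filing of the
retired route-AtomisticToContinuum-EinsteinBath, whose only defect was an Assembly naming the
Literature constant instead of the
sub-problem decl). THE BATHED GAS: the conjunct's N+1 hard spheres (mass 1, diameter ε_N =
hsDiameter σ N = σ(N+1)^(-1/3)) on 𝕋³
together with K_N = ⌊(N+1)^(1-a)⌋ ideal POINT particles of mass m_N = (N+1)^(-b) — a deterministic,
reversible, Lebesgue-preserving
hard-body mixture, typed on the library structure `PolydisperseHardSphereFlow (Torus.geometry (Fin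
3)) m σ` with per-particle masses
m = `Fin.append (fun _ => 1) (fun _ => m_N)` and diameters σ = `Fin.append (fun _ => ε_N) (fun _ =>
0)` (definitionally the library's
`twoSpecies (N+1) K_N 1 m_N` / `twoSpecies (N+1) K_N ε_N 0`, spelled with `Fin.append` since rev 1
so that the route imports only the
fact-free `PolydisperseHardSphereFlow`; sphere–sphere contact ε_N, sphere–point ε_N/2, points never
meet); joint initial law = local Gibbs
law of the spheres ⊗ K_N i.i.d. lights uniform outside the exclusion balls and Maxwellian of mass
m_N at θ₀(x), drift u₀(x) (so the
sphere marginal is EXACTLY localGibbsLaw: support BathMarginalExact). WINDOW 0 < a < 1/3, 0 < b <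
2/3 − 2a: bath energy / pressure
/ momentum-flux fraction N^(-a) → 0, kick √(m_Nθ) = N^(-b/2) → 0, Epstein randomisation rate per
sphere γ_N ≍ N^(1/3−a−b/2) → ∞ per unit
time but N^(−a−b/2) → 0 per collision — Olla–Varadhan–Yau's weak-noise regime θ(ε) → ∞, εθ(ε) → 0,
with the noise MADE OF MECHANICS.
EinsteinBathEuler (crux, rank 2): for SOME (a,b) in the window, the sphere fields of the bathed gas
obey the conjunct's conclusion
(convergence in probability to the classical hs-Euler solution before the first shock, same
hypotheses incl. the conjunct's
PACKING GUARD ρ_t(x)σ³ < η, ∃ η > 0 outermost (re-type p126922, rev 3), same σ₀-closure).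
BathRemoval (crux, rank 3): for EVERY (a,b) in the window and σ < 1, and every classical solution
obeying the packing guard (its own
∃ η > 0), Euler-scale convergence of the sphere fields of the bathed gas on [0,T) FOR EVERY
sphere–point mixture flow Ψ_N (quantified
INSIDE the hypothesis since rev 4) implies it for the bare hard-sphere flow (removal of a
thermodynamically negligible solvent). The
deciding theorem `closes : EinsteinBathEuler → BathRemoval → HydrodynamicLimit` has the two CRUXES
as its only hypotheses and is twelve
lines of logic (glue.lean; Sketch.lean rc 0, axioms propext/choice/Quot.sound); the construction
item MixedFlowExists (support: the
sphere–point Alexander theorem on 𝕋³) is a lemma for the provers of the cruxes — whoever removes the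
bath instantiates BathRemoval's
hypothesis at a mixture flow they construct — and no longer a hypothesis of `closes` (rev 4 = glue
repair `glue.non-crux-hypothesis`).
Lean: `EinsteinBathEuler ∧ BathRemoval`

## Assembly
DECIDING THEOREM (D-0027 §2.1; glue.lean, sorry-free, elaborated in Sketch.lean rc 0 with axioms
propext / Classical.choice /
Quot.sound; rev 4): `theorem closes (hE : EinsteinBathEuler) (hR : BathRemoval) : HydrodynamicLimit`
— hypotheses are the route's two
CRUX items only, conclusion is the sub-problem Statement decl `HydrodynamicLimit` (root def of
Summits/AtomisticToContinuum/HydrodynamicLimit/Statement.lean, the PACKING-GUARDED conjunct since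
re-type p126922) by name.
Proof (pure logic): EinsteinBathEuler yields η₁ and (a,b), BathRemoval yields η₂; answer η₀ := min
η₁ η₂; fix profiles;
EinsteinBathEuler yields σ₀; answer min(σ₀, 1); for σ below it, a classical Euler solution obeying
the guard ρσ³ < η₀ (hence both
cruxes' guards), flows Φ_N and the time-0 hypothesis, BathRemoval's hypothesis "for every mixture
flow Ψ and every s ∈ [0,T) the
bathed sphere fields converge" is EinsteinBathEuler's conclusion read at each Ψ, and BathRemoval
returns bare convergence at t
(σ < 1) — HydrodynamicLimit verbatim. No mixture flow is chosen inside `closes` any more (rev ≤ 3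
took Ψ_N from the support
MixedFlowExists, which the glue lint forbids: only cruxes may be hypotheses of `closes`, supports
must be proved); the existence of Ψ
is used where it belongs, inside the proof of BathRemoval. Given that existence the rev-4
BathRemoval is implied by the rev-3 one
(instantiate at any Ψ), and were no mixture flow to exist it would read as the conjunct on the
window — never vacuous.
BathMarginalExact, MixedFlowExists and BathStaysNegligible are not hypotheses of `closes` (sanity
certificate, construction lemma and
necessary condition respectively); Assembly := EinsteinBathEuler → BathRemoval → HydrodynamicLimit
is the type of `closes`.

Rationale: WHY THIS LINE. Olla–Varadhan–Yau (OllaVaradhanYau1993 Thm 2.1, weak noise θ(ε) → ∞, εθ(ε) → 0, §2.1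
p. 527) use their conservative velocity noise
for exactly one step, the ergodic one (LiveraniOlla1996, FritzFunakiLebowitz1994: Hamiltonian +
velocity noise ⇒ regular stationary
states are Gibbs) — the BoltzmannHypothesis barrier's published evasion (i). The mechanical theory
of Brownian motion supplies that
noise from Hamiltonian mechanics with THEOREMS behind it: a hard ball in an ideal gas converges to
the Ornstein–Uhlenbeck process as
m/M → 0 (DurrGoldsteinLebowitz1981 = Spohn1991 Thm 8.3 p. 121 with explicit γ, D (8.62)–(8.63);
DurrGoldsteinLebowitz1983;
CalderoniDurrKusuoka1989), several heavy bodies jointly with gas-mediated correlations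
(KusuokaLiang2010, Liang2018), many solute
particles in a deterministic fast solvent ⇒ correlated Brownian motions (Kotelenez 2007,
doi:10.1007/978-0-387-74317-2, Ch. 2, with
mean-field instead of hard-core coupling), kinetic twin DegondLucquinDesreux1996 (disparate-mass
collision operator → Fokker–Planck),
all resting on one EXACT structural fact — conditionally on the heavy paths the gas atoms are
independent — a law of large numbers,
not a chaos hypothesis. Imported area: stochastic-process limit theorems for mechanical Brownian
motion (probability) feeding the
relative-entropy method; dictionary [OVY noise intensity θ(ε)] ↦ [Epstein friction/kicks at rate
γ_N], [εθ(ε) → 0] ↦ [b < 2/3 − 2a],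
[modified kinetic energy] ↦ [bath friction as the large-velocity thermostat]. What it does that
other lines do not: VanishingNoise
(now contact dice) POSTULATES randomness inside collisions; here collisions stay specular and the
randomness is the initial data of a
second, ideal species, the fixed-window rung EinsteinBathEuler is a DETERMINISTIC positive-density
Euler theorem with the conjunct's
equation of state, and the return to the conjunct compares two deterministic Hamiltonian systems
with a second small parameter K/N.
CanestrariLiveraniOlla2026 (arXiv:2310.13338, heat equation from deterministic dynamics) is the
nearest "noise from determinism"
precedent: hyperbolic internal degrees of freedom, diffusive scale — not an ideal bath, not Euler.
Negatives index (3 on this sub: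
EnskogAdjointDuality test family, WarmCold* degenerate parameters) is respected: every Euler target
here is tied to the data by the
t = 0 hypothesis exactly as in the conjunct, and the window parameters of the Euler crux are
existential.

RANKED CRUXES. #2 EinsteinBathEuler (crux) — (card cruxes 1+2, rung R1) there are exponents 0 < a <
1/3, 0 < b < 2/3 − 2a such that for all continuous profiles a₀, θ₀ > 0, u₀ there is σ₀ > 0 with: for
σ ∈ (0,σ₀), every classical hs-Euler solution (ρ,u,θ) on [0,T) whose local packing stays below a
prover-chosen threshold (∃ η > 0 outermost; guard ρ_t(x)σ³ < η on [0,T) × 𝕋³ — verbatim the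
conjunct's guard since the statement re-type p126922, rev 3), all hard-sphere flows Φ_N (they only
fix the phase space of the local Gibbs law) and all sphere–point mixture flows Ψ_N (N+1 spheres of
diameter hsDiameter σ N and mass 1, K_N = ⌊(N+1)^(1−a)⌋ points of mass (N+1)^(−b)), if the local
Gibbs fields converge to (ρ,ρu,E)(0) at t = 0 then for every t ∈ [0,T) the empirical density /
momentum / energy fields of the SPHERE component of Ψ_N(t) converge in probability, under localGibbs
⊗ (i.i.d. lights uniform outside the exclusion balls × Maxwellian of mass m_N at θ₀(x), drift
u₀(x)), to ∫χρ_t, ∫χρ_t u_t, ∫χE_t. Layer 2: BathReduction (informal rank-4 crux, filed after open)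
+ OVY's theorem for hard spheres driven by the bath's exchange kernel, friction supplying the
large-velocity control. [deps: MixedFlowExists (to be non-vacuous), BathMarginalExact] [difficulty:
open-problem] (why it might fail: Bath reduction UNIFORM IN N is new (lights ping-pong between
spheres O(ε) apart: non-white exchange kernel, shadowing), and OVY still needed a modified kinetic
energy WITH noise (§1 p. 525): Epstein friction γ_N|v| must be shown to control |v|²/2 tails inside
the entropy method.) [OllaVaradhanYau1993, Spohn1991, DurrGoldsteinLebowitz1981, KusuokaLiang2010,
LiveraniOlla1996, FritzFunakiLebowitz1994, NachtergaeleYau2003, doi:10.1007/978-0-387-74317-2]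
#3 BathRemoval (crux) — (card crux 3, rungs R2–R3: removal of a vanishing solvent; rev 4: the
mixture flows are quantified INSIDE the hypothesis) for all (a,b) in the window, all σ ∈ (0,1),
continuous profiles (a₀, θ₀ > 0, u₀), hard-sphere flows Φ_N, every classical hs-Euler solution on
[0,T) obeying the packing guard ρ_t(x)σ³ < η (∃ η > 0 outermost, its own prover-chosen threshold;
rev 3) whose initial fields are the limits of the local Gibbs fields: if for EVERY family of
sphere–point mixture flows Ψ_N (N+1 spheres of diameter hsDiameter σ N and mass 1, K_N =
⌊(N+1)^(1−a)⌋ points of mass (N+1)^(−b)) and EVERY t ∈ [0,T) the sphere fields of the bathed gas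
Ψ_N(t) converge in probability (under the joint law localGibbs ⊗ conditioned ideal bath) to (∫χρ_t,
∫χρ_t u_t, ∫χE_t), then for every t ∈ [0,T) `TendstoHydroFieldsAt localGibbsLaw Φ ρ u θ t` — the
bare deterministic hard-sphere fields converge to the same Euler solution. Physically: a solvent
with energy / pressure / momentum-flux content O(N^(−a)), heat transport O(N^(−2a)) and
per-collision randomisation O(N^(−a−b/2)) does not change the Euler-scale fields of a dilute solute
before shocks. Rev 4 (glue repair): with `∀ Ψ` in the hypothesis the deciding theorem `closes :
EinsteinBathEuler → BathRemoval → HydrodynamicLimit` needs no construction hypothesis; the remover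
instantiates the hypothesis at a mixture flow it constructs (support MixedFlowExists, the
sphere–point Alexander theorem, a lemma of THIS proof); given that existence the rev-4 form is
implied by the rev-3 form (instantiate at any Ψ), and were no mixture flow to exist it would read as
the conjunct on the window — it never becomes vacuous. [deps: EinsteinBathEuler; MixedFlowExists
inside the proof] [difficulty: open-problem] (why it might fail: Given EinsteinBathEuler it is
conjunct-complete: Lyapunov rate ≍ N^(1/3) per unit time defeats pathwise coupling of bathed and
bare flows, and no law-level stability of Euler-scale fields under an o(1)-per-collision
conservative perturbation is known (cf. VanishingNoise.DiceContinuity).) [OllaVaradhanYau1993,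
Spohn1991, KusuokaLiang2010, arXiv:2310.13338]
#9 MixedFlowExists (support) — CONSTRUCTION item for the posited object (never smuggled into the
cruxes; since rev 4 NOT a hypothesis of `closes` either — a lemma for the provers of BathRemoval /
EinsteinBathEuler, provable by anyone idle): for all n, k, 0 < ε < 1/2, μ > 0 the sphere–point
mixture flow on 𝕋³ exists — `Nonempty (PolydisperseHardSphereFlow (Torus.geometry (Fin 3))
(Fin.append (fun _ => 1) (fun _ => μ)) (Fin.append (fun _ => ε) (fun _ => 0)))` (= the library's
`twoSpecies n k 1 μ` / `twoSpecies n k ε 0` unfolded) (n spheres of diameter ε and mass 1, k points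
of mass μ; contact distances ε, ε/2, 0). Alexander's a.e. construction for a binary hard-body
mixture on the torus: the case the library file PolydisperseHardSphereAlexander explicitly leaves as
a THEOREM to prove (template: HardSphereShortTime / HardSphereScattering / HardSphereAlexander;
collisions locally finite by Vaserstein 1979 / Burago–Ferleger–Kononenko 1998 for hard balls of
arbitrary masses, lifted locally from ℝ³). [difficulty: L] [AmpatzoglouMillerPavlovic2022,
Alexander1975, Vaserstein1979, BuragoFerlegerKononenko1998, GallagherSaintRaymondTexier2013]
#9 BathMarginalExact (support) — the bath is statically invisible (no depletion interaction): for σ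
∈ (0,1), continuous profiles (a₀, θ₀ > 0, u₀), every N, k, μ > 0 and flow Φ, the sphere marginal
(push-forward under restriction to the first N+1 indices) of the joint law [localGibbsLaw ⊗ k i.i.d.
lights with density (1 − πσ³/6)⁻¹·𝟙(outside all balls B(q_i, ε/2))·Maxwellian_μ(θ₀(x), u₀(x)),
pushed to Config (N+1+k) by Fin.append] IS localGibbsLaw σ a₀ u₀ θ₀ N Φ — the exclusion balls of
radius ε/2 around centres at mutual distance ≥ ε are disjoint, so the excluded volume (N+1)(π/6)ε³ =
πσ³/6 is configuration-independent (succ_mul_hsDiameter_pow_three) and each light factor integrates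
to 1. [difficulty: provable-now] [Spohn1991, doi:10.1007/978-0-387-74317-2]
#9 BathStaysNegligible (support) — the solvent stays thermodynamically negligible under the DYNAMICS
(typed form of the cheapest falsifier (β); a necessary condition of EinsteinBathEuler inside the
Euler horizon by energy conservation, filed for all times and the whole window): for all (a,b) in
the window, σ ∈ (0,1), continuous profiles, flows Φ_N, Ψ_N, every real t and δ > 0, the joint-law
probability that the bath kinetic energy per sphere (N+1)⁻¹ Σ_j m_N‖w_j(t)‖²/2 exceeds δ tends to 0
as N → ∞ (at t = 0 it is O(K_N/N) = O(N^(−a)) by Markov; for t ≠ 0 it is the statement that lights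
thermalise to the local sphere temperature and are not heated by ping-pong / compression beyond
O(K_N θ)). [difficulty: L] [Spohn1991, DegondLucquinDesreux1996, KusuokaLiang2010]

TWO-LAYER PLAN. EinsteinBathEuler ⇐ BathReduction → NoisyOVYBathKernel → EinsteinBathEuler (k = 2):
BathReduction (filed right after open as the informal
rank-4 crux; typed once the definition request "hard-sphere flow + conservative OU velocity-exchange
noise with a given kernel" lands)
says the sphere component of Ψ_N is o(1)-close, in law of smooth field statistics uniformly on
[0,T], to S_N(γ_N) = hard-sphere flow +
conservative Ornstein–Uhlenbeck momentum/energy exchange among spheres within the light mean free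
path λ_L = 4N^(−1/3)/(πσ²), with the
explicit Epstein/ping-pong kernel (fluctuation–dissipation w.r.t. the hard-sphere Gibbs law exact);
NoisyOVYBathKernel is
OllaVaradhanYau1993 Thm 2.1 for hard spheres with that kernel in the window (its large-velocity
input = OU friction surviving elastic
collisions, a Povzner-type estimate with damping). BathRemoval ⇐ (sub-window b ≥ 2/3 − 2a, γ_N → 0:
uniform-in-γ entropy bound) →
(removal at γ_N ≤ N^(−k)) → BathRemoval, only once a law-level stability handle appears.
BathStaysNegligible ⇐ (t = 0, Markov) →
(propagation by light thermalisation). Nothing here is filed now.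

KILL CRITERIA. Close `refuted:EinsteinBathEuler` if the bath provably fails to reduce anywhere in
the window (the crux is existential in (a,b), so a
refutation must cover the whole window: e.g. a proof that lights are heated / trapped so that
BathStaysNegligible fails for every
admissible (a,b), or that the two-species Euler system differs from hs-Euler at order 1 throughout).
¬BathStaysNegligible at some
corner forces a restated window (pivot, not a close). BathRemoval can only die with the conjunct
(given EinsteinBathEuler it is
equivalent to it); if VanishingNoise.DiceContinuity is refuted in a form covering Hamiltonian baths,
close this route too.
RelEntropyVanishing (stmt-AtomisticToContinuum-0766) or the conjunct proved elsewhere moots the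
route; EinsteinBathEuler would survive
as a theorem about a deterministic two-species gas. ¬MixedFlowExists (a Zeno phenomenon of positive
measure for sphere–point mixtures)
would make EinsteinBathEuler vacuous and collapse BathRemoval (rev 4) onto the bare conjunct — the
route would keep its correctness but
lose its content, forcing a re-typing over an a.e.-local flow — judged impossible by Vaserstein/BFK
collision bounds.

NOT DECOMPOSED YET. The reduced generator S_N(γ) and its kernel (definition request), the OU/Povzner
large-velocity estimate inside the entropy method,
block sizes and the one/two-block lemmas for the bath kernel, the quantitative (rate) version of
EinsteinBathEuler needed to push
γ_N → 0, the choice of (a,b) for removal, and the t = 0 / propagation split of BathStaysNegligible —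
all layer-2 children after
BathReduction is typed or a crux moves.

CHEAPEST FALSIFIER. (i) Two-sphere kernel computation (paper-and-pencil or kit): the m → 0 limit of
the bath-mediated momentum–energy exchange between two
spheres at distance r ∈ (ε, λ_L) (ping-pong series with view factors / shadowing) must be a smooth,
hypoelliptic, Gibbs-reversible
exchange kernel; if it exchanges only the radial momentum component, Liverani–Olla needs the
collisions' help and layer 2 of
EinsteinBathEuler weakens. (ii) Event-driven MD (points vs spheres is a trivial extension of any
hard-sphere code): φ = 0.05,
N = 10⁴, a = b = 1/6: check (α) sphere VACF damping ≈ Epstein γ_N from Spohn1991 (8.62), (β) bath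
energy fraction ≈ N^(−1/6) at
all times (BathStaysNegligible), (γ) a sound pulse in the spheres travels at the PURE hard-sphere
sound speed; failure of (γ) kills
the window bookkeeping. Not run here (plancard seat; kit not requested) — recorded for the refuter.

NUMBERS. Window exponents (spheres: diameter σN^(−1/3), collision rate ≍ N^(1/3); lights: K =
N^(1−a), m = N^(−b), speed N^(b/2), mean free
path 4N^(−1/3)/(πσ²), collision rate per light ≍ N^(1/3+b/2), per sphere ≍ N^(1/3−a+b/2)): bath
energy & pressure fraction N^(−a);
kick √(mθ) = N^(−b/2); γ_N ≍ (rate per sphere)·(kick)² = N^(1/3−a−b/2) (→ ∞ iff b < 2/3 − 2a; OVY: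
θ(ε) → ∞), per-collision fraction
N^(−a−b/2) → 0 (OVY: εθ(ε) → 0); light thermalisation rate N^(1/3−b/2) → ∞, light diffusivity
N^(b/2−1/3) → 0, bath heat flux /
sphere energy flux ≲ N^(−a+b/2−1/3) ≤ N^(−2a). Epstein/DGL drag on a sphere of radius R in an ideal
gas (n, m, θ):
γM = (8/3)√(2πmθ) n R² (Spohn1991 (8.62), d = 3). OVY regime: θ(ε) → ∞, εθ(ε) → 0
(OllaVaradhanYau1993 §2.1 p. 527). Items at open:
6 typed (2 crux, 3 support, 1 assembly) + 1 informal crux (BathReduction, rank 4) filed after open.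
Rev 4 (glue repair, 2026-08-16):
closes : EinsteinBathEuler → BathRemoval → HydrodynamicLimit (2 crux hypotheses, 12 lines, σ₀ :=
min(σ₀, 1), η₀ := min η₁ η₂; Sketch.lean
rc 0, axioms propext/Classical.choice/Quot.sound); BathRemoval restated (∀ Ψ into the hypothesis),
Assembly restated to the type of
closes; MixedFlowExists kept as support, off the deciding theorem.
CONE (route-repair rev 1, 2026-08-15; re-checked rev 3: 62 constants / 0 unproved): gate deps 63
project constants / 0 unproved, closes native OK, staffable; module import cone =
the Statement cone (12 Literature files: 58 zero-binder named Props, 54 discharged by *_holds, the 4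
remaining being the summit's four
CONJUNCT statements HydrodynamicLimit (target) / FouriersLaw / Crystallization /
BoseEinsteinCondensation, which enter every route of the
summit through the gate import Summits.AtomisticToContinuum.Statement — open problems, not
literature debt; needs-fact: none) plus the
fact-free PolydisperseHardSphereFlow + PolydisperseCollisionLaw.

DEFINITION REQUESTS. (1) LANDED since gen-1: Literature.Analysis.FluidPDE.PolydisperseHardSphereFlow
/ PolydisperseCollisionLaw — used by
every item (replaces gen-1's 2.3 kB inline predicate); the two-species parameter vectors are written
`Fin.append (fun _ => a) (fun _ => b)`
(definitionally `twoSpecies n k a b` of PolydisperseHardSphereAlexander, which the route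
deliberately does NOT import: that file carries the
undischarged named fact PolydisperseHardSphereFlow.nonempty = AmpatzoglouMillerPavlovic2022 Thm 3.1,
used by no item). (2) WANTED (filed after open with `ledger workitem add --kind definition`):
OUExchangeHardSphereDynamics (Summits/AtomisticToContinuum/HydrodynamicLimit/Theorems) — the
hard-sphere flow on 𝕋³ plus a
conservative (momentum- and energy-preserving) Ornstein–Uhlenbeck velocity-exchange noise with a
given smooth kernel of microscopic
range, as a Markov process / law on path space; needed to type BathReduction. Cite facts wanted (not
load-bearing for any typed item):
DurrGoldsteinLebowitz1981 main theorem (= Spohn1991 Thm 8.3), KusuokaLiang2010 main theorem.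

Novelty: Searches (2026-08-15): `lit search --hybrid "heavy particle ideal gas Brownian motion limit
Ornstein-Uhlenbeck mechanical model"`
(12 docs; Kotelenez 2007 book pp. 44–47, 63 READ: many large particles in a deterministic bath of
fast small particles, mean-field
coupling, mesoscopic correlated-Brownian limit; Spohn1991 §8.4 Thm 8.3 READ p. 121); `lit frontier
AtomisticToContinuum --since 2021`
(30 rows; nearest: CanestrariLiveraniOlla2026 arXiv:2310.13338, arXiv:2605.19694 nonideal
Rayleigh-gas mixture at Boltzmann–Grad,
doi:10.1007/s10955-026-03570-w binary collision model fluctuations — none couples an ideal bath to a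
dense sphere fluid for Euler);
`lit bridges AtomisticToContinuum --cross any` (30 rows, nothing relevant); `lit galaxy search
"mechanical model of Brownian motion"
--star all` (4 rows: Les Houches 2010 volume, SDE lecture notes — nothing new) and `"Brownian motion
in an ideal gas" --star all`
(0 rows); `lit search --source crossref "massive particle ideal gas Brownian motion limit"` (12;
Szász–Tóth 1987
doi:10.1007/bf01239014, one tracer); openalex / s2 legs rate-limited (HTTP 429) at the time of
search — recorded, not retried; the
card's own crossref searches (DGL, CDK, Kusuoka–Liang, CLS) and the refuter audit's added prior
(DegondLucquinDesreux1996,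
Kotelenez, Szász–Tóth).
Nearest prior art found: DurrGoldsteinLebowitz1981 / Spohn1991 Thm 8.3 (one body, m → 0, OU),
KusuokaLiang2010 (finitely many bodies,
gas-mediated coupling), Kotelenez 2007 doi:10.1007/978-  [refs: 10.1007/s10955-026-03570-w, 10.1007/bf01239014, 10.1007/978-0-387-74317-2, 2310.13338, 2605.19694, doi:10.1007/s10955-026-03570-w, doi:10.1007/bf01239014, doi:10.1007/978-0-387-74317-2, Spohn1991, CanestrariLiveraniOlla2026, DegondLucquinDesreux1996, DurrGoldsteinLebowitz1981, KusuokaLiang2010, ChernovLebowitzSinai2002, OllaVaradhanYau1993, LiveraniOlla1996]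

Barriers (technique_class: hamiltonian-bath-noise vanishing-solvent relative-entropy): - technique_class: hamiltonian-bath-noise vanishing-solvent relative-entropy
- Literature.Barriers.AtomisticToContinuum.BoltzmannHypothesisBarrier: EinsteinBathEuler evades it
the way OVY do — velocity noise supplies the ergodic step, published evasion (i) — but with the
noise DERIVED, valid iff BathReduction holds uniformly in N; for the conjunct (BathRemoval) it is
NOT evaded: it is converted into the solvent-removal stability statement, honestly ranked
conjunct-complete. The barrier's ideal-gas kernel is respected twice: the bath alone has no
hydrodynamics, and the bath acts only on velocities at range λ_L, so sphere–sphere collisions remain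
responsible for spatial structure.
- Literature.Barriers.AtomisticToContinuum.BoltzmannHypothesisBarrierNarrow: same — step (B) of OVY
§4 (momenta conditionally Maxwellian mixtures) is exactly what the Epstein kicks of the light bath
are meant to supply mechanically; steps (C)–(E) are deterministic already.
- Literature.Barriers.AtomisticToContinuum.HighMomentumCutoffBarrier: not evaded by fiat: OVY needed
a bounded-gradient kinetic energy even with noise (§1 p. 525); the bet is the NEW a-priori input —
Epstein friction at rate γ_N → ∞ per unit time gives exponential velocity-moment control along the
bathed dynamics (layer 2 of EinsteinBathEuler, to be proved; shared in spirit with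
LargeVelocityControl 0781); BathRemoval and `closes` never touch the entropy inequality.
- Literature.Barriers.AtomisticToContinuum.HighMomentumCutoffBarrie

History (route lifecycle, newest last):
- 2026-08-15T19:03:39Z · rev 1: restated EinsteinBathEuler (stmt-AtomisticToContinuum-11938), BathRemoval (stmt-AtomisticToContinuum-11939), MixedFlowExists (stmt-AtomisticToContinuum-11940), BathStaysNegligible (stmt-AtomisticToContinuum-11942) — route-repair (cone guardrail, gen 1; unit rrepair-AtomisticToContinuum-EinsteinB-f64124a3): RE-RO (planner-rrepair-AtomisticToContinuum-EinsteinB-f64124a3-0)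
- 2026-08-16T23:12:40Z · rev 3: restated EinsteinBathEuler (stmt-AtomisticToContinuum-13860), BathRemoval (stmt-AtomisticToContinuum-13861) — route-repair (statement re-type p126922, unit rrepair-AtomisticToContinuum-EinsteinB-2f446e9c): HydrodynamicLimit is now the PACKING-GUARDED def (∃ η₀ outermost (planner-rrepair-AtomisticToContinuum-EinsteinB-2f446e9c-0)
- 2026-08-16T23:23:03Z · rev 4: restated BathRemoval (stmt-AtomisticToContinuum-17282), Assembly (stmt-AtomisticToContinuum-11943) — route-repair (glue.non-crux-hypothesis, unit rbadge-AtomisticToContinuum-EinsteinBa-f64124a3): rev-3 `closes` took the SUPPORT item MixedFlowExists (sphere–poin (planner-rbadge-AtomisticToContinuum-EinsteinBa-f64124a3-0)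
- 2026-08-23T04:17:48Z · DORMANT — reconciler: no traction for 5.9 d (last activity item-evidence-added at 2026-08-17T06:18:57Z); parked, not closed — `ledger route dormant route-AtomisticToConti (operator:999:1031220)

sub-problem: HydrodynamicLimit · status: dormant · opened planner-plancard-AtomisticToContinuum-Hydrody-21be8e3f-g2-0 2026-08-15T18:46:15Z · rev 5 · ledger route-AtomisticToContinuum-EinsteinBathSolvent
GENERATED by the gate from the ledger (D-0016/17). Provers cite these decls: `theorem foo : Summit.AtomisticToContinuum.HydrodynamicLimit.Theses.EinsteinBathSolvent.<Decl> := …` in Summits/AtomisticToContinuum/HydrodynamicLimit/Theorems/<Name>.lean.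
-/

namespace Summit.AtomisticToContinuum.HydrodynamicLimit.Theses.EinsteinBathSolvent

open scoped BigOperators Topology Manifold Classical MeasureTheory ProbabilityTheory Matrix InnerProductSpace ComplexConjugate ContinuousMap
open Filter Set Function TopologicalSpace MeasureTheory

attribute [summit_statement] _root_.HydrodynamicLimit

-- earlier EinsteinBathEuler (stmt-AtomisticToContinuum-11938, replaced 2026-08-15T19:03:39Z -> stmt-AtomisticToContinuum-13860): retired by None — let TT := Literature.MathematicalPhysics.KineticTheory.T3; let VV := Literature.MathematicalPhysics.KineticTheory.V3; let CFG : ℕ → Type := fun n => Literature.Analysis.FluidPDE.Config n (Fin 3) TT; let G : Literature.Analysis.FluidPDE.Geometry (Fin 3) TT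
-- earlier EinsteinBathEuler (stmt-AtomisticToContinuum-13860, replaced 2026-08-16T23:12:40Z -> stmt-AtomisticToContinuum-17281): retired by None — let TT := Literature.MathematicalPhysics.KineticTheory.T3; let VV := Literature.MathematicalPhysics.KineticTheory.V3; let CFG : ℕ → Type := fun n => Literature.Analysis.FluidPDE.Config n (Fin 3) TT; let G : Literature.Analysis.FluidPDE.Geometry (Fin 3) TT
/-- item stmt-AtomisticToContinuum-17281 · crux · rank 2 · open · by planner
why it might fail: Bath reduction UNIFORM IN N is new (lights ping-pong between spheres O(ε) apart: non-white exchange kernel, shadowing), and OVY still needed a modified kinetic energy WITH noise (§1 p. 525): Epstein friction γ_N|v| must be shown to control |v|²/2 tails inside the entropy method.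
sources: OllaVaradhanYau1993, Spohn1991, DurrGoldsteinLebowitz1981, KusuokaLiang2010, LiveraniOlla1996, FritzFunakiLebowitz1994
[crux] (card cruxes 1+2, rung R1; PACKING-GUARDED since rev 3 = statement re-type p126922) there are
a packing threshold η > 0 (outermost, prover-chosen — verbatim the conjunct's guard) and exponents 0
< a < 1/3, 0 < b < 2/3 − 2a such that for all continuous profiles a₀, θ₀ > 0, u₀ there is σ₀ > 0
with: for σ ∈ (0,σ₀), every classical hs-Euler solution (ρ,u,θ) on [0,T) whose local packing stays
below η (∀ t ∈ [0,T) ∀ x, ρ_t(x)σ³ < η), all hard-sphere flows Φ_N (they only fix the phase space of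
the local Gibbs law) and all sphere–point mixture flows Ψ_N (N+1 spheres of diameter hsDiameter σ N
and mass 1, K_N = ⌊(N+1)^(1−a)⌋ points of mass (N+1)^(−b)), if the local Gibbs fields converge to
(ρ,ρu,E)(0) at t = 0 then for every t ∈ [0,T) the empirical density / momentum / energy fields of
the SPHERE component of Ψ_N(t) converge in probability, under localGibbs ⊗ (i.i.d. lights uniform
outside the exclusion balls × Maxwellian of mass m_N at θ₀(x), drift u₀(x)), to ∫χρ_t, ∫χρ_t u_t,
∫χE_t. The guard restricts the crux to solutions that stay a dilute FLUID (Spohn's regime; virial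
EOS analytic at small packing) exactly as the re-typed conjunct does, so the implosion /
close-packing typing e -/
@[route_item "route-AtomisticToContinuum-EinsteinBathSolvent", crux]
def EinsteinBathEuler : Prop :=
  let TT := Literature.MathematicalPhysics.KineticTheory.T3; let VV := Literature.MathematicalPhysics.KineticTheory.V3; let CFG : ℕ → Type := fun n => Literature.Analysis.FluidPDE.Config n (Fin 3) TT; let G : Literature.Analysis.FluidPDE.Geometry (Fin 3) TT := Literature.Analysis.FluidPDE.Torus.geometry (Fin 3); let D : TT → TT → ℝ := fun x y => ‖G.sepVec x y‖; let MF : (n k : ℕ) → ℝ → ℝ → Type := fun n k e μ => Literature.Analysis.FluidPDE.PolydisperseHardSphereFlow G (Fin.append (fun _ : Fin n => (1 : ℝ)) (fun _ : Fin k => μ)) (Fin.append (fun _ : Fin n => e) (fun _ : Fin k => (0 : ℝ))); ∃ η₀ : ℝ, 0 < η₀ ∧ ∃ a b : ℝ, 0 < a ∧ a < 1 / 3 ∧ 0 < b ∧ b < 2 / 3 - 2 * a ∧ ∀ (a₀ θ₀ : TT → ℝ) (u₀ : TT → VV), Continuous a₀ → Continuous θ₀ → Continuous u₀ → (∀ x,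 0 < a₀ x) → (∀ x, 0 < θ₀ x) → ∃ σ₀ : ℝ, 0 < σ₀ ∧ ∀ σ : ℝ, 0 < σ → σ < σ₀ → let ε : ℕ → ℝ := fun N => Literature.MathematicalPhysics.KineticTheory.hsDiameter σ N; ∀ (T : ℝ) (ρ θ : ℝ → TT → ℝ) (u : ℝ → TT → VV), Literature.MathematicalPhysics.KineticTheory.IsHardSphereEulerSolution σ T ρ u θ → (∀ t ∈ Set.Ico 0 T, ∀ x, ρ t x * σ ^ 3 < η₀) → ∀ Φ : (N : ℕ) → Literature.Analysis.FluidPDE.HardSphereFlow G (ε N) (N + 1), let K : ℕ → ℕ := fun N => ⌊((N : ℝ) + 1) ^ (1 - a)⌋₊; let m : ℕ → ℝ := fun N => ((N : ℝ) + 1) ^ (-b); let Tz : (ℕ → ENNReal) → Prop := fun f => Filter.Tendsto f Filter.atTop (nhds 0); let LG : (N : ℕ) → MeasureTheory.Measure (CFG (N + 1)) := fun N => Literature.MathematicalPhysics.KineticTheory.localGibbsLaw σ a₀ u₀ θ₀ N (Φ N); let P : (N : ℕ) → MeasureTheory.Measure (CFG (N + 1 + K N)) := fun N => MeasureTheory.Measure.map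 (fun x : CFG (N + 1) × CFG (K N) => (Fin.append x.1 x.2 : CFG (N + 1 + K N))) (((LG N).prod MeasureTheory.volume).withDensity (fun x => ENNReal.ofReal (∏ j, (1 - Real.pi * σ ^ 3 / 6)⁻¹ * (if ∀ i, ε N / 2 < D (x.2 j).1 (x.1 i).1 then (1 : ℝ) else 0) * Literature.Analysis.FluidPDE.localMaxwellian 1 (θ₀ (x.2 j).1 / m N) (u₀ (x.2 j).1) (x.2 j).2))); let SPH : (N : ℕ) → CFG (N + 1 + K N) → CFG (N + 1) := fun N z i => z (Fin.castAdd (K N) i); ∀ Ψ : (N : ℕ) → MF (N + 1) (K N) (ε N) (m N), Literature.MathematicalPhysics.KineticTheory.TendstoHydroFieldsAt LG Φ ρ u θ 0 → ∀ t ∈ Set.Ico 0 T, (∀ χ : TT → ℝ, Continuous χ → ∀ δ : ℝ, 0 < δ → Tz (fun N => P N {z | δ < |Literature.MathematicalPhysics.KineticTheory.empiricalDensityField (SPH N ((Ψ N).flow t z)) χ - ∫ y, χ y * ρ t y|}) ∧ Tz (fun N => P N {z | δ < ‖Literature.MathematicalPhysics.KineticTheory.empiricalMomentumField (SPH N ((Ψ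 N).flow t z)) χ - ∫ y, (χ y * ρ t y) • u t y‖}) ∧ Tz (fun N => P N {z | δ < |Literature.MathematicalPhysics.KineticTheory.empiricalEnergyField (SPH N ((Ψ N).flow t z)) χ - ∫ y, χ y * Literature.MathematicalPhysics.KineticTheory.totalEnergyDensity (ρ t y) (u t y) (θ t y)|}))

-- earlier BathRemoval (stmt-AtomisticToContinuum-11939, replaced 2026-08-15T19:03:39Z -> stmt-AtomisticToContinuum-13861): retired by None — let TT := Literature.MathematicalPhysics.KineticTheory.T3; let VV := Literature.MathematicalPhysics.KineticTheory.V3; let CFG : ℕ → Type := fun n => Literature.Analysis.FluidPDE.Config n (Fin 3) TT; let G : Literature.Analysis.FluidPDE.Geometry (Fin 3) TT := Li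
-- earlier BathRemoval (stmt-AtomisticToContinuum-13861, replaced 2026-08-16T23:12:40Z -> stmt-AtomisticToContinuum-17282): retired by None — let TT := Literature.MathematicalPhysics.KineticTheory.T3; let VV := Literature.MathematicalPhysics.KineticTheory.V3; let CFG : ℕ → Type := fun n => Literature.Analysis.FluidPDE.Config n (Fin 3) TT; let G : Literature.Analysis.FluidPDE.Geometry (Fin 3) TT := Li
-- earlier BathRemoval (stmt-AtomisticToContinuum-17282, replaced 2026-08-16T23:23:03Z -> stmt-AtomisticToContinuum-17598): retired by None — let TT := Literature.MathematicalPhysics.KineticTheory.T3; let VV := Literature.MathematicalPhysics.KineticTheory.V3; let CFG : ℕ → Type := fun n => Literature.Analysis.FluidPDE.Config n (Fin 3) TT; let G : Literature.Analysis.FluidPDE.Geometry (Fin 3) TT := Li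
/-- item stmt-AtomisticToContinuum-17598 · crux · rank 3 · open · by planner
why it might fail: Given EinsteinBathEuler it is conjunct-complete: Lyapunov rate ≍ N^(1/3) per unit time defeats pathwise coupling of bathed and bare flows, and no law-level stability of Euler-scale fields under an o(1)-per-collision conservative perturbation is known (cf. VanishingNoise.DiceContinuity).
sources: OllaVaradhanYau1993, Spohn1991, KusuokaLiang2010, arXiv:2310.13338
[crux] (card crux 3, rungs R2–R3: removal of a vanishing solvent; PACKING-GUARDED since rev 3 =
statement re-type p126922; rev 4 = glue repair: the mixture flows Ψ are quantified INSIDE the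
hypothesis) there is a packing threshold η > 0 (outermost, prover-chosen) such that for all (a,b) in
the window 0 < a < 1/3, 0 < b < 2/3 − 2a, all σ ∈ (0,1), continuous profiles (a₀, θ₀ > 0, u₀),
hard-sphere flows Φ_N and every classical hs-Euler solution on [0,T) obeying the guard ∀ t ∈ [0,T) ∀
x, ρ_t(x)σ³ < η whose initial fields are the limits of the local Gibbs fields: if for EVERY family
of sphere–point mixture flows Ψ_N (N+1 spheres of diameter hsDiameter σ N and mass 1, K_N =
⌊(N+1)^(1−a)⌋ points of mass (N+1)^(−b)) and EVERY t ∈ [0,T) the sphere fields of the bathed gas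
Ψ_N(t) converge in probability (under the joint law localGibbs ⊗ conditioned ideal light bath) to
(∫χρ_t, ∫χρ_t u_t, ∫χE_t), then for every t ∈ [0,T) `TendstoHydroFieldsAt localGibbsLaw Φ ρ u θ t` —
the bare deterministic hard-sphere fields converge to the same Euler solution. Physically: a solvent
with energy / pressure / momentum-flux content O(N^(−a)), heat transport O(N^(−2a)) and
per-collision randomisation O(N^(−a−b -/
@[route_item "route-AtomisticToContinuum-EinsteinBathSolvent", crux]
def BathRemoval : Prop :=
  let TT := Literature.MathematicalPhysics.KineticTheory.T3; let VV := Literature.MathematicalPhysics.KineticTheory.V3; let CFG : ℕ → Type := fun n => Literature.Analysis.FluidPDE.Config n (Fin 3) TT; let G : Literature.Analysis.FluidPDE.Geometry (Fin 3) TT := Literature.Analysis.FluidPDE.Torus.geometry (Fin 3); let D : TT → TT → ℝ := fun x y => ‖G.sepVec x y‖; let MF : (n k : ℕ) → ℝ → ℝ → Type := fun n k e μ => Literature.Analysis.FluidPDE.PolydisperseHardSphereFlow G (Fin.append (fun _ : Fin n => (1 : ℝ)) (fun _ : Fin k => μ)) (Fin.append (fun _ : Fin n => e) (fun _ : Fin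 k => (0 : ℝ))); ∃ η₀ : ℝ, 0 < η₀ ∧ ∀ (a b : ℝ), 0 < a → a < 1 / 3 → 0 < b → b < 2 / 3 - 2 * a → ∀ σ : ℝ, 0 < σ → σ < 1 → let ε : ℕ → ℝ := fun N => Literature.MathematicalPhysics.KineticTheory.hsDiameter σ N; ∀ (a₀ θ₀ : TT → ℝ) (u₀ : TT → VV), Continuous a₀ → Continuous θ₀ → Continuous u₀ → (∀ x, 0 < a₀ x) → (∀ x, 0 < θ₀ x) → ∀ Φ : (N : ℕ) → Literature.Analysis.FluidPDE.HardSphereFlow G (ε N) (N + 1), let K : ℕ → ℕ := fun N => ⌊((N : ℝ) + 1) ^ (1 - a)⌋₊; let m : ℕ → ℝ := fun N => ((N : ℝ) + 1) ^ (-b); let Tz : (ℕ → ENNReal) → Prop := fun f => Filter.Tendsto f Filter.atTop (nhds 0); let LG : (N : ℕ) → MeasureTheory.Measure (CFG (N + 1)) := fun N => Literature.MathematicalPhysics.KineticTheory.localGibbsLaw σ a₀ u₀ θ₀ N (Φ N); let P : (N : ℕ) → MeasureTheory.Measure (CFG (N + 1 + K N)) := fun N => MeasureTheory.Measure.map (fun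 x : CFG (N + 1) × CFG (K N) => (Fin.append x.1 x.2 : CFG (N + 1 + K N))) (((LG N).prod MeasureTheory.volume).withDensity (fun x => ENNReal.ofReal (∏ j, (1 - Real.pi * σ ^ 3 / 6)⁻¹ * (if ∀ i, ε N / 2 < D (x.2 j).1 (x.1 i).1 then (1 : ℝ) else 0) * Literature.Analysis.FluidPDE.localMaxwellian 1 (θ₀ (x.2 j).1 / m N) (u₀ (x.2 j).1) (x.2 j).2))); let SPH : (N : ℕ) → CFG (N + 1 + K N) → CFG (N + 1) := fun N z i => z (Fin.castAdd (K N) i); ∀ (T : ℝ) (ρ θ : ℝ → TT → ℝ) (u : ℝ → TT → VV), Literature.MathematicalPhysics.KineticTheory.IsHardSphereEulerSolution σ T ρ u θ → (∀ t ∈ Set.Ico 0 T, ∀ x, ρ t x * σ ^ 3 < η₀) → Literature.MathematicalPhysics.KineticTheory.TendstoHydroFieldsAt LG Φ ρ u θ 0 → (∀ Ψ : (N : ℕ) → MF (N + 1) (K N) (ε N) (m N), ∀ t ∈ Set.Ico 0 T, (∀ χ : TT → ℝ, Continuous χ → ∀ δ : ℝ, 0 < δ → Tz (fun N => P N {z |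 δ < |Literature.MathematicalPhysics.KineticTheory.empiricalDensityField (SPH N ((Ψ N).flow t z)) χ - ∫ y, χ y * ρ t y|}) ∧ Tz (fun N => P N {z | δ < ‖Literature.MathematicalPhysics.KineticTheory.empiricalMomentumField (SPH N ((Ψ N).flow t z)) χ - ∫ y, (χ y * ρ t y) • u t y‖}) ∧ Tz (fun N => P N {z | δ < |Literature.MathematicalPhysics.KineticTheory.empiricalEnergyField (SPH N ((Ψ N).flow t z)) χ - ∫ y, χ y * Literature.MathematicalPhysics.KineticTheory.totalEnergyDensity (ρ t y) (u t y) (θ t y)|}))) → ∀ t ∈ Set.Ico 0 T, Literature.MathematicalPhysics.KineticTheory.TendstoHydroFieldsAt LG Φ ρ u θ t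

-- item stmt-AtomisticToContinuum-12832 · support · rank 4 · open · by planner — informal only, no Lean statement yet:
--   [crux] BATH REDUCTION UNIFORM IN N (card crux 1; layer-2 child-to-be of EinsteinBathEuler, filed
--   informally until the definition request OUExchangeHardSphereDynamics lands). In the window 0<a<1/3,
--   0<b<2/3-2a, for local Gibbs sphere data tensor the conditioned ideal light bath of EinsteinBathEuler
--   (K_N = floor((N+1)^(1-a)) points of mass m_N = (N+1)^(-b), uniform outside the spheres, Maxwellian
--   at theta0(x), drift u0(x)) and t <= T: expectations of bounded Lipschitz statistics of the
--   chi-tested SPHERE density/momentum/energy fields under the sphere-point mixture flow Psi_N are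
--   within o(1), unif

/-- item stmt-AtomisticToContinuum-11941 · support · rank 9 · open · by planner
sources: Spohn1991, doi:10.1007/978-0-387-74317-2
[support] the bath is statically invisible (no depletion interaction): for σ ∈ (0,1), continuous
profiles (a₀, θ₀ > 0, u₀), every N, k, μ > 0 and flow Φ, the sphere marginal (push-forward under
restriction to the first N+1 indices) of the joint law [localGibbsLaw ⊗ k i.i.d. lights with density
(1 − πσ³/6)⁻¹·𝟙(outside all balls B(q_i, ε/2))·Maxwellian_μ(θ₀(x), u₀(x)), pushed to Config (N+1+k)
by Fin.append] IS localGibbsLaw σ a₀ u₀ θ₀ N Φ — the exclusion balls of radius ε/2 around centres at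
mutual distance ≥ ε are disjoint, so the excluded volume (N+1)(π/6)ε³ = πσ³/6 is
configuration-independent (succ_mul_hsDiameter_pow_three) and each light factor integrates to 1.
[difficulty: provable-now] -/
@[route_item "route-AtomisticToContinuum-EinsteinBathSolvent"]
def BathMarginalExact : Prop :=
  let TT := Literature.MathematicalPhysics.KineticTheory.T3; let VV := Literature.MathematicalPhysics.KineticTheory.V3; let CFG : ℕ → Type := fun n => Literature.Analysis.FluidPDE.Config n (Fin 3) TT; let G : Literature.Analysis.FluidPDE.Geometry (Fin 3) TT := Literature.Analysis.FluidPDE.Torus.geometry (Fin 3); let D : TT → TT → ℝ := fun x y => ‖G.sepVec x y‖; ∀ σ : ℝ, 0 < σ → σ < 1 → ∀ (a₀ θ₀ : TT → ℝ) (u₀ : TT → VV), Continuous a₀ → Continuous θ₀ → Continuous u₀ → (∀ x, 0 < a₀ x) → (∀ x, 0 < θ₀ x) → ∀ (N k : ℕ) (μ : ℝ), 0 < μ → ∀ Φ : Literature.Analysis.FluidPDE.HardSphereFlow G (Literature.MathematicalPhysics.KineticTheory.hsDiameter σ N) (N + 1), (MeasureTheory.Measure.map (fun x : CFG (N + 1)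 × CFG k => (Fin.append x.1 x.2 : CFG (N + 1 + k))) (((Literature.MathematicalPhysics.KineticTheory.localGibbsLaw σ a₀ u₀ θ₀ N Φ).prod MeasureTheory.volume).withDensity (fun x => ENNReal.ofReal (∏ j, (1 - Real.pi * σ ^ 3 / 6)⁻¹ * (if ∀ i, Literature.MathematicalPhysics.KineticTheory.hsDiameter σ N / 2 < D (x.2 j).1 (x.1 i).1 then (1 : ℝ) else 0) * Literature.Analysis.FluidPDE.localMaxwellian 1 (θ₀ (x.2 j).1 / μ) (u₀ (x.2 j).1) (x.2 j).2)))).map (fun z : CFG (N + 1 + k) => (fun i => z (Fin.castAdd k i) : CFG (N + 1))) = Literature.MathematicalPhysics.KineticTheory.localGibbsLaw σ a₀ u₀ θ₀ N Φ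

-- earlier MixedFlowExists (stmt-AtomisticToContinuum-11940, replaced 2026-08-15T19:03:39Z -> stmt-AtomisticToContinuum-13862): retired by None — let TT := Literature.MathematicalPhysics.KineticTheory.T3; let G : Literature.Analysis.FluidPDE.Geometry (Fin 3) TT := Literature.Analysis.FluidPDE.Torus.geometry (Fin 3); let MF : (n k : ℕ) → ℝ → ℝ → Type := fun n k e μ => Literature.Analysis.FluidPDE.Poly
/-- item stmt-AtomisticToContinuum-13862 · support · rank 9 · open · by planner
sources: AmpatzoglouMillerPavlovic2022, Alexander1975, Vaserstein1979, BuragoFerlegerKononenko1998, GallagherSaintRaymondTexier2013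
[support] CONSTRUCTION item for the posited object (never smuggled into the cruxes; hypothesis of
`closes`): for all n, k, 0 < ε < 1/2, μ > 0 the sphere–point mixture flow on 𝕋³ exists — `Nonempty
(PolydisperseHardSphereFlow (Torus.geometry (Fin 3)) (Fin.append (fun _ => 1) (fun _ => μ))
(Fin.append (fun _ => ε) (fun _ => 0)))` (per-particle masses 1,…,1,μ,…,μ and diameters ε,…,ε,0,…,0,
i.e. the library's `twoSpecies n k 1 μ` / `twoSpecies n k ε 0` unfolded) (n spheres of diameter ε
and mass 1, k points of mass μ; contact distances ε, ε/2, 0). Alexander's a.e. construction for a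
binary hard-body mixture on the torus: the case the library file PolydisperseHardSphereAlexander
explicitly leaves as a THEOREM to prove (template: HardSphereShortTime / HardSphereScattering /
HardSphereAlexander; collisions locally finite by Vaserstein 1979 / Burago–Ferleger–Kononenko 1998
for hard balls of arbitrary masses, lifted locally from ℝ³). [difficulty: L] [cone repair rev 1: the
mixture parameters are spelled `Fin.append (fun _ => 1) (fun _ => μ)` / `Fin.append (fun _ => ε)
(fun _ => 0)` — definitionally the library's `twoSpecies n k 1 μ` / `twoSpecies n k ε 0` — so that
the route file imports on -/
@[route_item "route-AtomisticToContinuum-EinsteinBathSolvent"]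
def MixedFlowExists : Prop :=
  let TT := Literature.MathematicalPhysics.KineticTheory.T3; let G : Literature.Analysis.FluidPDE.Geometry (Fin 3) TT := Literature.Analysis.FluidPDE.Torus.geometry (Fin 3); let MF : (n k : ℕ) → ℝ → ℝ → Type := fun n k e μ => Literature.Analysis.FluidPDE.PolydisperseHardSphereFlow G (Fin.append (fun _ : Fin n => (1 : ℝ)) (fun _ : Fin k => μ)) (Fin.append (fun _ : Fin n => e) (fun _ : Fin k => (0 : ℝ))); ∀ (n k : ℕ) (e μ : ℝ), 0 < e → e < 2⁻¹ → 0 < μ → Nonempty (MF n k e μ)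

-- earlier BathStaysNegligible (stmt-AtomisticToContinuum-11942, replaced 2026-08-15T19:03:39Z -> stmt-AtomisticToContinuum-13863): retired by None — let TT := Literature.MathematicalPhysics.KineticTheory.T3; let VV := Literature.MathematicalPhysics.KineticTheory.V3; let CFG : ℕ → Type := fun n => Literature.Analysis.FluidPDE.Config n (Fin 3) TT; let G : Literature.Analysis.FluidPDE.Geometry (Fin 3) 
/-- item stmt-AtomisticToContinuum-13863 · support · rank 9 · open · by planner
sources: Spohn1991, DegondLucquinDesreux1996, KusuokaLiang2010
[support] the solvent stays thermodynamically negligible under the DYNAMICS (typed form of the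
cheapest falsifier (β); a necessary condition of EinsteinBathEuler inside the Euler horizon by
energy conservation, filed for all times and the whole window): for all (a,b) in the window, σ ∈
(0,1), continuous profiles, flows Φ_N, Ψ_N, every real t and δ > 0, the joint-law probability that
the bath kinetic energy per sphere (N+1)⁻¹ Σ_j m_N‖w_j(t)‖²/2 exceeds δ tends to 0 as N → ∞ (at t =
0 it is O(K_N/N) = O(N^(−a)) by Markov; for t ≠ 0 it is the statement that lights thermalise to the
local sphere temperature and are not heated by ping-pong / compression beyond O(K_N θ)).
[difficulty: L] [cone repair rev 1: the mixture parameters are spelled `Fin.append (fun _ => 1) (fun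
_ => μ)` / `Fin.append (fun _ => ε) (fun _ => 0)` — definitionally the library's `twoSpecies n k 1
μ` / `twoSpecies n k ε 0` — so that the route file imports only the fact-free
`Literature.Analysis.FluidPDE.PolydisperseHardSphereFlow` and not `PolydisperseHardSphereAlexander`
with its undischarged AMP 2022 Thm 3.1; meaning unchanged.] -/
@[route_item "route-AtomisticToContinuum-EinsteinBathSolvent"]
def BathStaysNegligible : Prop :=
  let TT := Literature.MathematicalPhysics.KineticTheory.T3; let VV := Literature.MathematicalPhysics.KineticTheory.V3; let CFG : ℕ → Type := fun n => Literature.Analysis.FluidPDE.Config n (Fin 3) TT; let G : Literature.Analysis.FluidPDE.Geometry (Fin 3) TT := Literature.Analysis.FluidPDE.Torus.geometry (Fin 3); let D : TT → TT → ℝ := fun x y => ‖G.sepVec x y‖; let MF : (n k : ℕ) → ℝ → ℝ → Type := fun n k e μ => Literature.Analysis.FluidPDE.PolydisperseHardSphereFlow G (Fin.append (fun _ : Fin n => (1 : ℝ)) (fun _ : Fin k => μ)) (Fin.append (fun _ : Fin n => e) (fun _ : Fin k => (0 : ℝ))); ∀ (a b : ℝ), 0 < a → a < 1 / 3 → 0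 < b → b < 2 / 3 - 2 * a → ∀ σ : ℝ, 0 < σ → σ < 1 → let ε : ℕ → ℝ := fun N => Literature.MathematicalPhysics.KineticTheory.hsDiameter σ N; ∀ (a₀ θ₀ : TT → ℝ) (u₀ : TT → VV), Continuous a₀ → Continuous θ₀ → Continuous u₀ → (∀ x, 0 < a₀ x) → (∀ x, 0 < θ₀ x) → ∀ Φ : (N : ℕ) → Literature.Analysis.FluidPDE.HardSphereFlow G (ε N) (N + 1), let K : ℕ → ℕ := fun N => ⌊((N : ℝ) + 1) ^ (1 - a)⌋₊; let m : ℕ → ℝ := fun N => ((N : ℝ) + 1) ^ (-b); let Tz : (ℕ → ENNReal) → Prop := fun f => Filter.Tendsto f Filter.atTop (nhds 0); let LG : (N : ℕ) → MeasureTheory.Measure (CFG (N + 1)) := fun N => Literature.MathematicalPhysics.KineticTheory.localGibbsLaw σ a₀ u₀ θ₀ N (Φ N); let P : (N : ℕ) → MeasureTheory.Measure (CFG (N + 1 + K N)) := fun N => MeasureTheory.Measure.map (fun x : CFG (N + 1) × CFG (K N) => (Fin.append x.1 x.2 : CFG (N + 1 + K N))) (((LG N).prod MeasureTheory.volume).withDensity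 (fun x => ENNReal.ofReal (∏ j, (1 - Real.pi * σ ^ 3 / 6)⁻¹ * (if ∀ i, ε N / 2 < D (x.2 j).1 (x.1 i).1 then (1 : ℝ) else 0) * Literature.Analysis.FluidPDE.localMaxwellian 1 (θ₀ (x.2 j).1 / m N) (u₀ (x.2 j).1) (x.2 j).2))); ∀ Ψ : (N : ℕ) → MF (N + 1) (K N) (ε N) (m N), ∀ (t δ : ℝ), 0 < δ → Tz (fun N => P N {z | δ < ((N : ℝ) + 1)⁻¹ * ∑ j : Fin (K N), m N / 2 * ‖(((Ψ N).flow t z) (Fin.natAdd (N + 1) j)).2‖ ^ 2})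

-- earlier Assembly (stmt-AtomisticToContinuum-11943, replaced 2026-08-16T23:23:03Z -> stmt-AtomisticToContinuum-17599): retired by None — MixedFlowExists → EinsteinBathEuler → BathRemoval → HydrodynamicLimit
/-- item stmt-AtomisticToContinuum-17599 · assembly · rank 1 · open · by planner
sources: Spohn1991, OllaVaradhanYau1993
[assembly] EinsteinBathEuler → BathRemoval → HydrodynamicLimit — the type of the deciding theorem
`closes` (rev 4: the two cruxes only, no construction hypothesis); `assembly : Assembly := closes`. -/
@[route_item "route-AtomisticToContinuum-EinsteinBathSolvent"]
def Assembly : Prop :=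
  EinsteinBathEuler → BathRemoval → HydrodynamicLimit

/-! D-0027 §2.1 — DECIDING THEOREM (planner-authored via `route open/edit --closes-file`; by planner-rbadge-AtomisticToContinuum-EinsteinBa-f64124a3-g2-0 2026-08-16T23:40:44Z):
its hypotheses are this route's items and its conclusion the sub-problem Statement (glue_lint), and it elaborates with this file. -/

@[closes "route-AtomisticToContinuum-EinsteinBathSolvent"] theorem closes (hE : EinsteinBathEuler) (hR : BathRemoval) : HydrodynamicLimit := by
  -- rev 5 (2026-08-16): re-certified unchanged against the packing-guarded `HydrodynamicLimit`
  -- (`∃ η₀, 0 < η₀ ∧ ∀ a₀ θ₀ u₀ …`); pure logic: η₀ := min η₁ η₂, σ₀ := min σ₀ 1.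
  obtain ⟨η₁, hη₁, a, b, ha1, ha2, hb1, hb2, hE'⟩ := hE
  obtain ⟨η₂, hη₂, hR'⟩ := hR
  refine ⟨min η₁ η₂, lt_min hη₁ hη₂, fun a₀ θ₀ u₀ ha hθ hu ha0 hθ0 => ?_⟩
  obtain ⟨σ₀, hσ₀, H⟩ := hE' a₀ θ₀ u₀ ha hθ hu ha0 hθ0
  refine ⟨min σ₀ 1, lt_min hσ₀ one_pos, fun σ hσ hσ' T ρ θ u hEu hG Φ h0 t ht => ?_⟩
  have hσ1 : σ < σ₀ := lt_of_lt_of_le hσ' (min_le_left _ _)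
  have hσ2 : σ < 1 := lt_of_lt_of_le hσ' (min_le_right _ _)
  have hG1 : ∀ s ∈ Set.Ico 0 T, ∀ x, ρ s x * σ ^ 3 < η₁ :=
    fun s hs x => lt_of_lt_of_le (hG s hs x) (min_le_left _ _)
  have hG2 : ∀ s ∈ Set.Ico 0 T, ∀ x, ρ s x * σ ^ 3 < η₂ :=
    fun s hs x => lt_of_lt_of_le (hG s hs x) (min_le_right _ _)
  exact hR' a b ha1 ha2 hb1 hb2 σ hσ hσ2 a₀ θ₀ u₀ ha hθ hu ha0 hθ0 Φ T ρ θ u hEu hG2 h0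
    (fun Ψ s hs => H σ hσ hσ1 T ρ θ u hEu hG1 Φ Ψ h0 s hs) t ht

end Summit.AtomisticToContinuum.HydrodynamicLimit.Theses.EinsteinBathSolvent
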